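import Mathlib
import Summits.Ventures.PercRepro2.IFRTail
import Summits.Ventures.PercRepro2.IFRConv
import Summits.Ventures.PercRepro2.IFRSP
import Summits.Ventures.PercRepro2.IFRFlowLaw
import Summits.Ventures.PercRepro2.IFRSPFamily

/-!
# BAL, STEP and the hazard form for the random flow of a series–parallel network (seat mine-b, cell pub-perc-repro2)

Transport of `IFRSPFamily.lean` along `SP.prob_eq_tail` (`IFRFlowLaw.lean`): for the random flow `F` of any
two-terminal series–parallel network with independent edges,
* `SP.prob_balanced`: `P(F ≥ a−1)·P(F ≥ b+1) ≤ P(F ≥ a)·P(F ≥ b)` for `a ≤ b` (BAL),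
* `SP.prob_step`: `P(F = i)·P(F ≥ j) ≤ P(F = i+1)·P(F ≥ j−1)` for `i + 2 ≤ j` (STEP),
* `SP.prob_hazard`: `P(F = j)·P(F ≥ j') ≤ P(F = j')·P(F ≥ j)` for `j ≤ j'` (the discrete hazard rate
  `P(F = k | F ≥ k)` is non-decreasing: `F` is IFR).
`P(F = i)` is written as the difference `t.prob i - t.prob (i + 1)` (= `SP.prob_sub`).
-/

namespace Summit.Ventures.PercRepro2.IFR

/-- BAL for the random flow. -/
theorem SP.prob_balanced (t : SP) {a b : ℤ} (hab : a ≤ b) :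
    t.prob (a - 1) * t.prob (b + 1) ≤ t.prob a * t.prob b := by
  simp only [SP.prob_eq_tail]; exact SP.tail_balanced t hab

/-- STEP for the random flow, with `P(F = i) = P(F ≥ i) − P(F ≥ i+1)`. -/
theorem SP.prob_step (t : SP) {i j : ℤ} (hij : i + 2 ≤ j) :
    (t.prob i - t.prob (i + 1)) * t.prob j ≤ (t.prob (i + 1) - t.prob (i + 1 + 1)) * t.prob (j - 1) := by
  simp only [SP.prob_eq_tail]; exact SP.tail_step t hij

/-- the hazard rate of the random flow is non-decreasing (`F` is IFR). -/
theorem SP.prob_hazard (t : SP) {j j' : ℤ} (h : j ≤ j') :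
    (t.prob j - t.prob (j + 1)) * t.prob j' ≤ (t.prob j' - t.prob (j' + 1)) * t.prob j := by
  simp only [SP.prob_eq_tail]; exact (SP.tail_isLCTail t).hazard h

end Summit.Ventures.PercRepro2.IFR
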